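import Mathlib.Algebra.MvPolynomial.Eval
import Mathlib.Order.Monotone.Basic
import Mathlib.Algebra.Group.Even
import HarnessLib

/-!
# Uniform zero-test algebraic Karchmer–Wigderson protocols (`AlgKWProtocol`, `KWSolvable`)

Definition request `defn-KWSolvable` (route ValiantsHypothesis/AlgebraicKWGames). The MESSAGE MODEL
of algebraic communication complexity (M. Bläser, E. Vicari, SAGT 2008, §3 Definition 1: the players
send, in turn, field elements `m_i ∈ k(X, m_1, …, m_{i-1})` resp. `k(Y, m_1, …, m_{i-1})`, rational —
or, for division-free protocols, polynomial — in the speaker's own input and the elements announced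
so far; §6: decision protocols additionally branch on EQUALITY TESTS; the model goes back to
H. Abelson, J. ACM 27 (1980) and Luo–Tsitsiklis) combined with the Karchmer–Wigderson SEARCH relation
(the "find-a-difference game": given `a`, `b` with `f(a) ≠ f(b)`, find a coordinate `i` with
`aᵢ ≠ bᵢ`; S. Jukna, *Boolean Function Complexity*, §3.3 and Thm. 3.13 = Karchmer–Wigderson 1990),
in the UNIFORM ZERO-TEST form fixed by the route and INLINED verbatim in its items `KWPerLowerBound`,
`BoundedAlternationLowerBound`, `ProtocolToFormula`, `FormulaToProtocol`, `OneAlternationLowerBound`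
(this precise combination is the route's own formalisation; the cites document its two ingredients):

* a protocol of depth `D` over the coordinates `ι` is `(owner, msg, out)`: at round `t`, after the
  public history `z|<t ∈ {0,1}ᵗ` of ZERO BITS of the announced elements, the player
  `owner t z|<t` (`true` = the holder of `a`) announces `m_t = msg t z|<t (own input, m|<t) ∈ k`, a
  POLYNOMIAL in her own coordinates and the `t` previously announced elements, and the bit
  `z_t = [m_t = 0]` becomes public; after `D` rounds the leaf `out z|<D ∈ ι` is output;
* it SOLVES `KW_f` if `a_{out} ≠ b_{out}` whenever `f(a) ≠ f(b)`;
* cost convention: one round = one field element + its zero bit (the algebraic KW cost up to a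
  factor `2`); the bounded-alternation variant has an OBLIVIOUS speaker schedule `t ↦ blk t`,
  monotone with values `≤ Δ`, Alice speaking in the even blocks.

## Contents

* `AlgKWProtocol k ι D` (structure: `owner`, `msg`, `out`); `transcript P a b : ℕ → k` and
  `zeroPattern P a b : ℕ → Bool` by well-founded recursion on the round (`transcript_eq`,
  `zeroPattern_eq_true_iff`); `AlgKWProtocol.Solves`, **`KWSolvable f D`**, the oblivious-schedule
  protocols `AlgKWProtocol.ofSchedule` and **`KWSolvableAlt f D Δ`**.
* PROVED: uniqueness of consistent transcripts (`eq_transcript_of_consistent`: any `(m, z)` obeying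
  the announcement equations for `t < D` and `z = [m = 0]` agrees with the transcript below `D`) —
  this is the "existence/uniqueness of the consistent transcript" of the request, existence being the
  definition; the UNFOLDING lemmas **`kwSolvable_iff_inline`** and **`kwSolvableAlt_iff_inline`**
  (the route's inline blocks are literally `KWSolvable f D` / `KWSolvableAlt f D Δ`);
  `KWSolvableAlt.kwSolvable`; padding `KWSolvable.mono` (`D ≤ D'`, dummy zero messages) and
  `KWSolvableAlt.mono_depth`.

Design: `k` any commutative semiring (the route: `ℂ`); the zero test uses classical decidability
(`Classical.dec`), matching the route's `z j = true ↔ m j = 0`. Not here: cost lower bounds, the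
rank/fibre-dimension adversary, Boolean KW games (Mathlib has none either; searched
`Karchmer`, `communication protocol`: nothing).

## References

* [BlaserVicari2008] M. Bläser, E. Vicari, Distributed algorithmic mechanism design and algebraic
  communication complexity, in: Algorithmic Game Theory (SAGT 2008), LNCS 4997, 206–217, §3 Def. 1
  (two-way protocols, messages `m_i ∈ k(X, m_1, …, m_{i-1})`; division-free protocols), §6
  (decision protocols with equality tests) — read in the SAGT 2008 volume.
* [JuknaBFC2012] S. Jukna, Boolean Function Complexity: Advances and Frontiers, Springer 2012, §3.3
  "Games and circuit depth" (the find-a-difference game for `f⁻¹(1) × f⁻¹(0)`), Thm. 3.13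
  (Karchmer and Wigderson 1990: `D(f) = 𝔠(f)`).
* [KarchmerWigderson1990] M. Karchmer, A. Wigderson, Monotone circuits for connectivity require
  super-logarithmic depth, SIAM J. Discrete Math. 3 (1990) 255–265 (the original of Thm. 3.13; cited
  through Jukna).
* [Abelson1980] H. Abelson, Lower bounds on information transfer in distributed computations,
  J. ACM 27 (1980) 384–392 (origin of the algebraic message model; cited by the route, not consulted
  here: acquisition request acq-03396).
-/

noncomputable section

open MvPolynomial

namespace Literature.Computability.AlgebraicComplexity

universe u v

/-- A **uniform zero-test algebraic KW protocol** of depth `D` over the coordinate type `ι` and the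
commutative semiring `k`: `owner t h` — who speaks at round `t` after the public zero-bit history
`h : Fin t → Bool` (`true` = the holder of `a`); `msg t h` — the announced polynomial in the
speaker's own coordinates `ι` and the `t` previously announced elements `Fin t`; `out h` — the leaf
label after `D` rounds. [cite: BlaserVicari2008, §3 Def. 1 and §6 (the message model with equality tests)]
[cite: JuknaBFC2012, §3.3 (find-a-difference game), Thm. 3.13 (Karchmer–Wigderson 1990)] -/
structure AlgKWProtocol (k : Type u) [CommSemiring k] (ι : Type v) (D : ℕ) where
  /-- The speaker at round `t` given the zero-bit history (`true` = Alice, the holder of `a`). -/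
  owner : (t : ℕ) → (Fin t → Bool) → Bool
  /-- The message polynomial at round `t` given the history: in the speaker's coordinates and the
  `t` previous announcements. -/
  msg : (t : ℕ) → (Fin t → Bool) → MvPolynomial (ι ⊕ Fin t) k
  /-- The output coordinate after `D` rounds. -/
  out : (Fin D → Bool) → ι

namespace AlgKWProtocol

variable {k : Type u} [CommSemiring k] {ι : Type v} {D : ℕ} (P : AlgKWProtocol k ι D) (a b : ι → k)

/-- The **transcript** `m_t` of the protocol on inputs `(a, b)`:
`m_t = eval (own input, m|<t) (msg t z|<t)` with `z_j = [m_j = 0]`, by well-founded recursion on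
`t` (the announcements beyond round `D` are defined too and never used).
[cite: BlaserVicari2008, §3 Def. 1 (messages `m_i ∈ k[X, m_1, …, m_{i-1}]`, division-free)] -/
def transcript : ℕ → k
  | t => MvPolynomial.eval
      (Sum.elim (if P.owner t (fun j : Fin t ↦ @decide (transcript j = 0) (Classical.dec _)) then a else b)
        (fun j : Fin t ↦ transcript j))
      (P.msg t (fun j : Fin t ↦ @decide (transcript j = 0) (Classical.dec _)))
  termination_by t => t
  decreasing_by all_goals exact Fin.isLt _

/-- The public **zero pattern** `z_t = [m_t = 0]` of the transcript (the outcomes of the equality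
tests). [cite: BlaserVicari2008, §6 (decision protocols with equality tests)] -/
def zeroPattern (t : ℕ) : Bool :=
  @decide (P.transcript a b t = 0) (Classical.dec _)

/-- `z_t = true ↔ m_t = 0`. [folklore] -/
theorem zeroPattern_eq_true_iff (t : ℕ) : P.zeroPattern a b t = true ↔ P.transcript a b t = 0 := by
  unfold zeroPattern
  exact @decide_eq_true_iff _ (Classical.dec _)

/-- The announcement equation: `m_t = eval (speaker's input, m|<t) (msg t z|<t)`.
[cite: BlaserVicari2008, §3 Def. 1] -/
theorem transcript_eq (t : ℕ) :
    P.transcript a b t = MvPolynomial.eval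
      (Sum.elim (if P.owner t (fun j : Fin t ↦ P.zeroPattern a b j) then a else b)
        (fun j : Fin t ↦ P.transcript a b j))
      (P.msg t (fun j : Fin t ↦ P.zeroPattern a b j)) := by
  rw [transcript]
  rfl

/-- The protocol **solves the KW game of `f`**: whenever `f(a) ≠ f(b)`, the output coordinate
separates `a` from `b`. [cite: JuknaBFC2012, §3.3 (find-a-difference game)] [cite: KarchmerWigderson1990, (the relation `KW_f`)] -/
def Solves (f : MvPolynomial ι k) : Prop :=
  ∀ a b : ι → k, MvPolynomial.eval a f ≠ MvPolynomial.eval b f →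
    a (P.out fun j : Fin D ↦ P.zeroPattern a b j) ≠ b (P.out fun j : Fin D ↦ P.zeroPattern a b j)

/-- **Uniqueness of the consistent transcript**: any pair `(m, z)` with `z_j = [m_j = 0]` for all
`j` and obeying the announcement equations for the rounds `t < D` agrees with
`(transcript, zeroPattern)` below `D`. [folklore] -/
theorem eq_transcript_of_consistent {m : ℕ → k} {z : ℕ → Bool} (hz : ∀ j, z j = true ↔ m j = 0)
    (hm : ∀ t < D, m t = MvPolynomial.eval
      (Sum.elim (if P.owner t (fun j : Fin t ↦ z j) then a else b) (fun j : Fin t ↦ m j))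
      (P.msg t (fun j : Fin t ↦ z j))) :
    ∀ t < D, m t = P.transcript a b t ∧ z t = P.zeroPattern a b t := by
  intro t
  induction t using Nat.strong_induction_on with
  | _ t ih =>
    intro ht
    have hmt : m t = P.transcript a b t := by
      have hzj : (fun j : Fin t ↦ z j) = fun j : Fin t ↦ P.zeroPattern a b j :=
        funext fun j ↦ (ih j j.2 (lt_trans j.2 ht)).2
      have hmj : (fun j : Fin t ↦ m j) = fun j : Fin t ↦ P.transcript a b j :=
        funext fun j ↦ (ih j j.2 (lt_trans j.2 ht)).1
      rw [hm t ht, transcript_eq, hzj, hmj]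
    refine ⟨hmt, ?_⟩
    rw [Bool.eq_iff_iff, hz t, zeroPattern_eq_true_iff, hmt]

end AlgKWProtocol

section Solvable

variable {k : Type u} [CommSemiring k] {ι : Type v}

/-- **`KW_f` is solvable in depth `D`** by a uniform zero-test algebraic protocol.
[cite: JuknaBFC2012, §3.3, Thm. 3.13] [cite: BlaserVicari2008, §3 Def. 1, §6] -/
def KWSolvable (f : MvPolynomial ι k) (D : ℕ) : Prop :=
  ∃ P : AlgKWProtocol k ι D, P.Solves f

/-- The protocol with an OBLIVIOUS speaker schedule given by the block index `blk` (Alice speaks iff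
the block index is even). [cite: BlaserVicari2008, §3 Def. 1 (the index sets `M_{A→B}`, `M_{A←B}`)] -/
def AlgKWProtocol.ofSchedule {D : ℕ} (blk : ℕ → ℕ) (msg : (t : ℕ) → (Fin t → Bool) → MvPolynomial (ι ⊕ Fin t) k)
    (out : (Fin D → Bool) → ι) : AlgKWProtocol k ι D where
  owner t _ := decide (Even (blk t))
  msg := msg
  out := out

/-- **`KW_f` is solvable in depth `D` with at most `Δ` alternations**: by a protocol whose speaker
schedule is oblivious — a monotone block index `blk ≤ Δ`, Alice speaking in the even blocks.
[cite: BlaserVicari2008, §3 Def. 1, §6] [cite: JuknaBFC2012, §3.3] -/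
def KWSolvableAlt (f : MvPolynomial ι k) (D Δ : ℕ) : Prop :=
  ∃ (blk : ℕ → ℕ) (msg : (t : ℕ) → (Fin t → Bool) → MvPolynomial (ι ⊕ Fin t) k)
    (out : (Fin D → Bool) → ι), Monotone blk ∧ (∀ t, blk t ≤ Δ) ∧
      (AlgKWProtocol.ofSchedule blk msg out).Solves f

/-- Bounded alternation is a special case. [folklore] -/
theorem KWSolvableAlt.kwSolvable {f : MvPolynomial ι k} {D Δ : ℕ} (h : KWSolvableAlt f D Δ) :
    KWSolvable f D := by
  obtain ⟨blk, msg, out, -, -, hS⟩ := h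
  exact ⟨_, hS⟩

/-! ### The unfolding lemmas: the route's inline blocks are `KWSolvable` / `KWSolvableAlt` -/

/-- The inline "solves" clause of the route items, for given `(owner, msg, out)`: quantified over
ALL consistent pairs `(m, z)`. [folklore] -/
def InlineSolves {D : ℕ} (f : MvPolynomial ι k) (owner : (t : ℕ) → (Fin t → Bool) → Bool)
    (msg : (t : ℕ) → (Fin t → Bool) → MvPolynomial (ι ⊕ Fin t) k) (out : (Fin D → Bool) → ι) : Prop :=
  ∀ a b : ι → k, MvPolynomial.eval a f ≠ MvPolynomial.eval b f →
    ∀ (m : ℕ → k) (z : ℕ → Bool), (∀ j, z j = true ↔ m j = 0) →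
      (∀ t < D, m t = MvPolynomial.eval
        (Sum.elim (if owner t (fun j : Fin t ↦ z j) then a else b) (fun j : Fin t ↦ m j))
        (msg t (fun j : Fin t ↦ z j))) →
      a (out fun j : Fin D ↦ z j) ≠ b (out fun j : Fin D ↦ z j)

/-- For a protocol, the inline clause is equivalent to `Solves` (the transcript is the unique
consistent pair). [folklore] -/
theorem AlgKWProtocol.inlineSolves_iff {D : ℕ} (P : AlgKWProtocol k ι D) (f : MvPolynomial ι k) :
    InlineSolves f P.owner P.msg P.out ↔ P.Solves f := by
  constructor
  · intro h a b hab
    exact h a b hab (P.transcript a b) (P.zeroPattern a b) (P.zeroPattern_eq_true_iff a b)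
      fun t _ ↦ P.transcript_eq a b t
  · intro h a b hab m z hz hm
    have hzD : (fun j : Fin D ↦ z j) = fun j : Fin D ↦ P.zeroPattern a b j :=
      funext fun j ↦ (P.eq_transcript_of_consistent a b hz hm j j.2).2
    rw [hzD]
    exact h a b hab

/-- **`kwSolvable_iff_inline`**: the inline block
`∃ owner msg out, ∀ a b, f a ≠ f b → ∀ m z, (z = [m = 0]) → (announcement equations, t < D) →
a_{out z|<D} ≠ b_{out z|<D}` of items `KWPerLowerBound`, `ProtocolToFormula`, `FormulaToProtocol`
IS `KWSolvable f D`. [folklore] -/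
theorem kwSolvable_iff_inline (f : MvPolynomial ι k) (D : ℕ) :
    KWSolvable f D ↔
      ∃ (owner : (t : ℕ) → (Fin t → Bool) → Bool)
        (msg : (t : ℕ) → (Fin t → Bool) → MvPolynomial (ι ⊕ Fin t) k) (out : (Fin D → Bool) → ι),
        ∀ a b : ι → k, MvPolynomial.eval a f ≠ MvPolynomial.eval b f →
          ∀ (m : ℕ → k) (z : ℕ → Bool), (∀ j, z j = true ↔ m j = 0) →
            (∀ t < D, m t = MvPolynomial.eval
              (Sum.elim (if owner t (fun j : Fin t ↦ z j) then a else b) (fun j : Fin t ↦ m j))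
              (msg t (fun j : Fin t ↦ z j))) →
            a (out fun j : Fin D ↦ z j) ≠ b (out fun j : Fin D ↦ z j) := by
  change KWSolvable f D ↔
    ∃ (owner : (t : ℕ) → (Fin t → Bool) → Bool)
      (msg : (t : ℕ) → (Fin t → Bool) → MvPolynomial (ι ⊕ Fin t) k) (out : (Fin D → Bool) → ι),
      InlineSolves f owner msg out
  constructor
  · rintro ⟨P, hP⟩
    exact ⟨P.owner, P.msg, P.out, (P.inlineSolves_iff f).2 hP⟩
  · rintro ⟨owner, msg, out, h⟩
    exact ⟨⟨owner, msg, out⟩, (AlgKWProtocol.inlineSolves_iff ⟨owner, msg, out⟩ f).1 h⟩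

/-- **`kwSolvableAlt_iff_inline`**: the inline block of items `BoundedAlternationLowerBound`
(`Δ` arbitrary) and `OneAlternationLowerBound` (`Δ = 1`) — `∃ blk msg out, Monotone blk ∧ blk ≤ Δ ∧
(the clause with speaker `Even (blk t)`)` — IS `KWSolvableAlt f D Δ`. [folklore] -/
theorem kwSolvableAlt_iff_inline (f : MvPolynomial ι k) (D Δ : ℕ) :
    KWSolvableAlt f D Δ ↔
      ∃ (blk : ℕ → ℕ) (msg : (t : ℕ) → (Fin t → Bool) → MvPolynomial (ι ⊕ Fin t) k)
        (out : (Fin D → Bool) → ι), Monotone blk ∧ (∀ t, blk t ≤ Δ) ∧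
        ∀ a b : ι → k, MvPolynomial.eval a f ≠ MvPolynomial.eval b f →
          ∀ (m : ℕ → k) (z : ℕ → Bool), (∀ j, z j = true ↔ m j = 0) →
            (∀ t < D, m t = MvPolynomial.eval
              (Sum.elim (if Even (blk t) then a else b) (fun j : Fin t ↦ m j))
              (msg t (fun j : Fin t ↦ z j))) →
            a (out fun j : Fin D ↦ z j) ≠ b (out fun j : Fin D ↦ z j) := by
  have key : ∀ (blk : ℕ → ℕ) (msg : (t : ℕ) → (Fin t → Bool) → MvPolynomial (ι ⊕ Fin t) k)
      (out : (Fin D → Bool) → ι),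
      (∀ a b : ι → k, MvPolynomial.eval a f ≠ MvPolynomial.eval b f →
          ∀ (m : ℕ → k) (z : ℕ → Bool), (∀ j, z j = true ↔ m j = 0) →
            (∀ t < D, m t = MvPolynomial.eval
              (Sum.elim (if Even (blk t) then a else b) (fun j : Fin t ↦ m j))
              (msg t (fun j : Fin t ↦ z j))) →
            a (out fun j : Fin D ↦ z j) ≠ b (out fun j : Fin D ↦ z j)) ↔
        InlineSolves f (AlgKWProtocol.ofSchedule blk msg out).owner msg out := by
    intro blk msg out
    simp only [InlineSolves, AlgKWProtocol.ofSchedule, decide_eq_true_eq]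
  constructor
  · rintro ⟨blk, msg, out, hmono, hle, hS⟩
    exact ⟨blk, msg, out, hmono, hle,
      (key blk msg out).2 ((AlgKWProtocol.inlineSolves_iff _ f).2 hS)⟩
  · rintro ⟨blk, msg, out, hmono, hle, h⟩
    exact ⟨blk, msg, out, hmono, hle, (AlgKWProtocol.inlineSolves_iff _ f).1 ((key blk msg out).1 h)⟩

/-! ### Padding: more rounds never hurt -/

/-- Padding a protocol of depth `D` to depth `D' ≥ D`: keep the first `D` rounds, then announce the
zero polynomial, and read the output off the first `D` zero bits. [folklore] -/
def AlgKWProtocol.pad {D D' : ℕ} (P : AlgKWProtocol k ι D) (h : D ≤ D') : AlgKWProtocol k ι D' where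
  owner t hist := if t < D then P.owner t hist else true
  msg t hist := if t < D then P.msg t hist else 0
  out hist := P.out fun j : Fin D ↦ hist (Fin.castLE h j)

/-- Below round `D` the padded protocol has the original speakers … [folklore] -/
theorem AlgKWProtocol.pad_owner_of_lt {D D' : ℕ} (P : AlgKWProtocol k ι D) (h : D ≤ D') {t : ℕ}
    (ht : t < D) (hist : Fin t → Bool) : (P.pad h).owner t hist = P.owner t hist :=
  if_pos ht

/-- … and the original messages. [folklore] -/
theorem AlgKWProtocol.pad_msg_of_lt {D D' : ℕ} (P : AlgKWProtocol k ι D) (h : D ≤ D') {t : ℕ}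
    (ht : t < D) (hist : Fin t → Bool) : (P.pad h).msg t hist = P.msg t hist :=
  if_pos ht

/-- The padded protocol has the same transcript below round `D`. [folklore] -/
theorem AlgKWProtocol.transcript_pad {D D' : ℕ} (P : AlgKWProtocol k ι D) (h : D ≤ D') (a b : ι → k) :
    ∀ t < D, (P.pad h).transcript a b t = P.transcript a b t ∧
      (P.pad h).zeroPattern a b t = P.zeroPattern a b t := by
  refine P.eq_transcript_of_consistent a b ((P.pad h).zeroPattern_eq_true_iff a b) fun t ht ↦ ?_
  rw [(P.pad h).transcript_eq a b t, P.pad_owner_of_lt h ht, P.pad_msg_of_lt h ht]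

/-- **`KWSolvable.mono`**: solvability in depth `D` gives solvability in every depth `D' ≥ D`.
[folklore] -/
theorem KWSolvable.mono {f : MvPolynomial ι k} {D D' : ℕ} (h : KWSolvable f D) (hD : D ≤ D') :
    KWSolvable f D' := by
  obtain ⟨P, hP⟩ := h
  refine ⟨P.pad hD, fun a b hab ↦ ?_⟩
  have key : (fun j : Fin D ↦ (P.pad hD).zeroPattern a b ((Fin.castLE hD j : Fin D') : ℕ)) =
      fun j : Fin D ↦ P.zeroPattern a b j := by
    funext j
    rw [Fin.val_castLE]
    exact (P.transcript_pad hD a b j j.2).2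
  change a (P.out fun j : Fin D ↦ (P.pad hD).zeroPattern a b ((Fin.castLE hD j : Fin D') : ℕ)) ≠
    b (P.out fun j : Fin D ↦ (P.pad hD).zeroPattern a b ((Fin.castLE hD j : Fin D') : ℕ))
  rw [key]
  exact hP a b hab

/-- The same padding for the bounded-alternation variant (the schedule is extended by its last
block, keeping monotonicity and the bound). [folklore] -/
theorem KWSolvableAlt.mono_depth {f : MvPolynomial ι k} {D D' Δ : ℕ} (h : KWSolvableAlt f D Δ)
    (hD : D ≤ D') : KWSolvableAlt f D' Δ := by
  obtain ⟨blk, msg, out, hmono, hle, hS⟩ := h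
  refine ⟨blk, fun t hist ↦ if t < D then msg t hist else 0,
    fun hist ↦ out fun j : Fin D ↦ hist (Fin.castLE hD j), hmono, hle, ?_⟩
  -- the padded oblivious protocol IS the pad of the oblivious protocol, up to the owner of the
  -- dummy rounds, which does not affect transcripts below `D`
  set P : AlgKWProtocol k ι D := AlgKWProtocol.ofSchedule blk msg out with hPdef
  set Q : AlgKWProtocol k ι D' := AlgKWProtocol.ofSchedule blk
    (fun t hist ↦ if t < D then msg t hist else 0) (fun hist ↦ out fun j : Fin D ↦ hist (Fin.castLE hD j))
    with hQdef
  intro a b hab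
  have hQ : ∀ t < D, Q.transcript a b t = P.transcript a b t ∧ Q.zeroPattern a b t = P.zeroPattern a b t := by
    refine P.eq_transcript_of_consistent a b (Q.zeroPattern_eq_true_iff a b) fun t ht ↦ ?_
    rw [Q.transcript_eq a b t]
    simp only [hQdef, hPdef, AlgKWProtocol.ofSchedule, if_pos ht]
  have key : (fun j : Fin D ↦ Q.zeroPattern a b ((Fin.castLE hD j : Fin D') : ℕ)) =
      fun j : Fin D ↦ P.zeroPattern a b j := by
    funext j
    rw [Fin.val_castLE]
    exact (hQ j j.2).2
  change a (out fun j : Fin D ↦ Q.zeroPattern a b ((Fin.castLE hD j : Fin D') : ℕ)) ≠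
    b (out fun j : Fin D ↦ Q.zeroPattern a b ((Fin.castLE hD j : Fin D') : ℕ))
  rw [key]
  exact hS a b hab

end Solvable

end Literature.Computability.AlgebraicComplexity

end
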